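import Literature.NumberTheory.EllipticCurves.BSDSelmerPConverseRationalHeegnerDescentProofs
import Literature.NumberTheory.EllipticCurves.IwasawaAlgebraProofs
import Literature.NumberTheory.EllipticCurves.BSDSelmerCMPConverse
import HarnessLib

/-!
# Burungale–Tian 2020, Thm. 1.2: the `Λ`-module and ideal-theoretic skeleton of §3.4 and §4.2.3

Third sibling *proofs* file (theorems only: no definition, no named fact, no instance —
D-0014/D-0026) of `Literature.NumberTheory.EllipticCurves.BSDSelmerCMPConverse`, for its named fact
`Literature.NumberTheory.EllipticCurves.burungaleTian_analyticRank_eq_one_of_selmerCorank_eq_one_of_hasCM`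
(A. A. Burungale, Y. Tian, *`p`-converse to a theorem of Gross–Zagier, Kolyvagin and Rubin*, Invent.
Math. 220 (2020), 211–253, **Thm. 1.2** (p. 214): for a CM elliptic curve `E/ℚ` and a good ordinary
prime `p > 3`, `corank_{ℤ_p} Sel_{p^∞}(E/ℚ) = 1 ⟹ ord_{s=1} L(s, E/ℚ) = 1`). The first two siblings
(`BSDSelmerCMPConverseRankOneProofs`, `BSDSelmerPConverseRankOneRubinProofs`) prove what the tree's
`E/ℚ`-level vocabulary can say (the printed last step with and without parity; the exact residual
in three forms). This file opens the DEEP half along the printed proof — §4.2.3 "Proof of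
Theorem 4.4" (pp. 249–250) and the proof of the Heegner main conjecture in the CM case, Thm. 3.2,
§3.4 (pp. 242–244) — whose objects (the anticyclotomic `Λ`-adic Selmer groups `S(B)`, `X(B)`,
`S(λ)`, `X(λ)`, `X(ψ*χ)` of §3.2, Disegni's `Λ`-adic Heegner class `κ`, the Katz and Rankin–Selberg
`p`-adic `L`-functions of §3.3, the `Λ`-adic height regulators `R(g × χ)`, `R(λ)` of §3.2.4, the
Shimura-curve abelian variety `B/K` and its Heegner point `P_{g,χ}`) exist neither in Mathlib nor in
`Literature/`. As in the tree's other skeleton files (`KatoDivisibilitySkeletonProofs`,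
`BSDSelmerPConverseHeegnerMainConjectureProofs` for Wan's Thm. 3.17,
`BSDSelmerPConverseRationalHeegnerDescentProofs` for Yan–Zhu, `BSDSelmerKimPConverseSkeletonProofs`
for Kim, `BSDSelmerCMPConverseKatoDescentProofs` for the rank-zero companion Burungale–Tian 2026)
they are ABSTRACT modules over the Iwasawa algebra `Λ = IwasawaAlgebra p = ℤ_[p]⟦T⟧` and abstract
ideals / elements, the printed inputs about them are explicit hypotheses, and what the source PROVES
about them is proved — nothing is asserted, no `def … : Prop` is added.

The printed proof (read in full from the openly deposited author manuscript of the published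
version, NSF-PAR 10184490, text key `paper:url-85381420cd53`; locators are Springer's pagination):

* **§3.4, proof of Thm. 3.2, HMC (ii)** (pp. 243–244). "We have `Λ°`-adic Gross–Zagier formula
  `⟨κ, κ^ι⟩ ≐ L'_p(g × χ)` due to Disegni [18, Thm. C]. […] It then follows that
  (3.4) `(L'_p(g × χ)) = (⟨κ, κ^ι⟩) = Char_Λ S(B)/(κ) · Char_Λ (S(B)/(κ))^ι · R(g × χ)`.
  […] (IMC'2) `(L'_Σ(λ)) = Char_Λ X(λ)_tor · R(λ)` [Agboola–Howard [2, Thm. A], Arnold [3, Thm. 2.14,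
  4.17]] […] (IMC2) `(L⁻_Σ*(ψ*χ)) = Char_Λ X(ψ*χ)` [Rubin [38, Thm. 4.1]]. We thus have
  (3.5) `(L'_Σ(λ) · L⁻_Σ*(ψ*χ)) = Char_Λ X(λ)_tor · Char_Λ X(ψ*χ) · R(λ)`. Non-vanishing. […]
  (3.6) `R(g × χ) = R(λ) ≠ 0`. […] From the anticyclotomic IMC […] non-vanishing of the anticyclotomic
  regulator `R(λ)` follows from that of `L'_Σ(λ)`. […] HMC. From Corollary 3.16, Lemma 3.7 and
  Corollary 3.8, we conclude that `Char_Λ S(B)/(κ) · Char_Λ (S(B)/(κ))^ι · R(g × χ) = Char(X(B)_tor) · R(λ)`.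
  In view of (3.4), (3.5) and (3.6), it thus follows that
  `Char_Λ S(B)/(κ) · Char_Λ (S(B)/(κ))^ι = Char(X(B)_tor)`." — with **Cor. 3.16** (p. 241) the
  factorisation `L'_p(g × χ) ≐ L'_Σ(λ) · L⁻_Σ*(ψ*χ)`, **Lemma 3.7 / Cor. 3.8** (pp. 234–235) the Selmer
  decomposition along `V ≅ L(λ) ⊕ L(ψ*χ)` and `Char_Λ X(W)_tor = Char_Λ X(λ)_tor · Char_Λ X(ψ*χ)_tor`,
  and **Prop. 3.9** (p. 235) the ranks `rank_Λ S(V ⊗ Λ) = 1`, `rank_Λ S(L(λ) ⊗ Λ) = 1`,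
  `rank_Λ S(L(ψ*χ) ⊗ Λ) = 0`, "the analogous result holds for the divisible Selmer groups `X(·)`".
* **§4.2.3, proof of Thm. 4.4 ⊇ Thm. 1.2** (pp. 249–250): *Parity* (4.2); *Auxiliary twist* (4.3)
  `L(1, λ*χ/χ*) ≠ 0`; *Self-dual pair*: "`L(s, g × χ) = L(s, λ) · L(s, λ*χ/χ*)` […] By (4.3), we thus
  have `ord_{s=1} L(s, λ) = 1 ⟺ ord_{s=1} L(s, g × χ) = 1`" and Yuan–Zhang–Zhang:
  "`ord_{s=1} L(s, λ) = 1 ⟺ P_{g,χ} ≠ 0`"; *Heegner main conjecture*: (4.4) and Lemma 3.7 give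
  "`corank_L (Sel_{p^∞}(B/K) ⊗_{𝒪₀} L) = 1`", (4.5) = HMC (ii), "The Iwasawa module `X(B)` has
  `Λ`-rank one (Proposition 3.9)"; *Descent*: "(4.6) `X(B)/I · X(B) → Sel_{p^∞}(B/K)^∨ ⊗_{𝒪₀} L` with
  finite kernel and cokernel […] As `corank_L (Sel_{p^∞}(B/K) ⊗_{𝒪₀} L) = 1`, we first note that
  `X(B)/I · X(B)` is not a torsion `L`-module (4.6). In view of HMC (4.5), it now follows that the
  Heegner cohomology class corresponding to the Heegner point `P_{g,χ}` is non-trivial. This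
  finishes the proof."

## What is proved

Dictionary. The source's `Λ` is the anticyclotomic Iwasawa algebra `𝒪⟦Γ_K^-⟧` with the coefficient
ring `𝒪 = 𝒪_L` of §3.2.1 (and its HMC is "the rational version", Remark 2.3); `γ^- ↦ 1 + T` carries
`I = (γ^- - 1)` to `(T)`, so `X/I·X` is the tree's `IwasawaAlgebra.coinvariants p X` and the prime
`(T)` is `primeT p`. The tree's `IwasawaAlgebra p` is hard-wired to `ℤ_[p]⟦T⟧`: the theorems of
the section "§4.2.3 — Descent" are the case `[L : ℚ_p] = 1` of the printed descent in the shape of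
the sibling files (`S` torsion-free of rank one, `κ ∈ S`), and the last section ("General
coefficients") proves the rank-`d` (`d = [𝒪 : ℤ_p]`) forms of Steps 1 and 3 that the general case
needs after RESTRICTION OF SCALARS from `Λ_𝒪 = 𝒪⟦T⟧` to `ℤ_[p]⟦T⟧` (`X(B)` of `Λ`-rank `d` with
`rank_{ℤ_p} X(B)/I = d`; the Heegner module `F = Λ_𝒪 · κ ⊆ S(B)` with `F/TF ≅ 𝒪` torsion-free), so
that the descent holds for every coefficient ring `𝒪` without an `𝒪`-coefficient Iwasawa-algebra
API. "An equality of ideals `⊗ ℚ_p`" / "`≐` up to `ℚ_p^×`" is written, as in the sibling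
skeleton files, with denominators cleared: `c₁ · I = c₂ · J` for nonzero constants `cᵢ ∈ ℤ_p ⊂ Λ`
(`PowerSeries.C cᵢ`). The involution `ι` of `Λ` is not needed as such: of (4.5) only the fact that
`Char_Λ (S(B)/(κ))^ι` is SOME ideal multiplying `Char_Λ S(B)/(κ)` is used, so it enters as an
abstract ideal `Aι`.

* **§3.4, HMC (ii) from the `GL₁` main conjectures** — pure ideal arithmetic in a commutative domain
  `R` (take `R = Λ ⊗ ℚ_p`, a principal ideal domain, where "`≐`" and "an equality of ideals arising
  from both sides" are exact): `BurungaleTian2019.charIdeal_mul_conj_eq_of_gl1MainConjectures` —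
  from (3.4) `(L'_p) = A · Aι · R_g`, (IMC'2) `(L'_Σ(λ)) = C_λ · R_λ`, (IMC2) `(L⁻(ψ*χ)) = C_ψ`,
  Cor. 3.16 `(L'_p) = (L'_Σ(λ)) · (L⁻(ψ*χ))`, Cor. 3.8 + Lemma 3.7 `C_tor = C_λ · C_ψ` and (3.6)
  `R_g = R_λ = (r)`, `r ≠ 0`, conclude `A · Aι = C_tor`, by cancelling the nonzero principal ideal
  `(r)` (`Ideal.span_singleton_mul_right_inj`); with the printed derivation of `R(λ) ≠ 0` from
  `L'_Σ(λ) ≠ 0` through (IMC'2) (`….ne_bot_of_span_singleton_eq_mul`) and, over `Λ`, the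
  principality of the regulator ideal as a characteristic ideal ([2, Def. 3.1.3]; tree theorem
  `charIdeal_isPrincipal_holds`): `….charIdeal_mul_conj_eq_of_gl1MainConjectures_of_regulator`.
* **Lemma 3.7 / Cor. 3.8 / Prop. 3.9, module theory of the decomposition** over a Noetherian domain
  (resp. over `Λ`): `isTorsion_prod`, `charIdeal_prod` (`char(M₁ ⊕ M₂) = char M₁ · char M₂` for
  finitely generated torsion modules, from the tree's multiplicativity in short exact sequences
  `Module.charIdeal_eq_mul_of_exact`), `charIdeal_torsion_prod` (**Cor. 3.8**:
  `char((M₁ ⊕ M₂)_tor) = char((M₁)_tor) · char((M₂)_tor)`, through the short exact sequence of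
  torsion submodules), `charIdeal_torsion_prod_of_isTorsion` (the form used in §3.4, `X(ψ*χ)` being
  torsion by (IMC1): `char(X(B)_tor) = char X(λ)_tor · char X(ψ*χ)`), `finrank_prod_eq_add`
  (rank–nullity over a domain), **Prop. 3.9** in the two shapes used: `finrank_prod_eq_one_of_isTorsion`
  (`rank_Λ X(B) = rank_Λ X(λ) + rank_Λ X(ψ*χ) = 1 + 0`) and `finrank_prod_eq_one_of_finrank_eq_zero`
  (`rank_Λ S(B) = 1 + 0`), and `noZeroSMulDivisors_prod` ("Torsion-free. In view of Lemma 3.7, it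
  suffices to show that `S(λ)` and `S(ψ*χ)` are `Λ`-torsion-free", p. 243).
* **§4.2.3, Descent** over `Λ = ℤ_[p]⟦T⟧`, in the shape the source uses — `S = S(B)` finitely
  generated, torsion-free, of rank one (HMC (i)), `κ ∈ S` nonzero; `X = X(B)` finitely generated of
  rank one (Prop. 3.9) with its torsion SUBMODULE `X_tor = Submodule.torsion Λ X`; (4.5) with
  denominators cleared, `c₁ · (Char(S/Λκ) · Aι) = c₂ · Char(X_tor)`, `c₂ ≠ 0`; and
  `rank_{ℤ_p} X/TX ≤ 1` ((4.6) with `corank = 1`):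
  `IwasawaAlgebra.span_C_mul_le_of_hmc` ((4.5) ⟹ the unsquared rational inclusion
  `c₂ · Char(X_tor) ⊆ Char(S/Λκ)`, all that is used), `….lengthAt_quotient_span_singleton_eq_zero_of_hmc`
  (`(S/Λκ)_𝔭 = 0` at `𝔭 = (T)`: Step 1 in Howard's shape, tree theorem
  `finite_coinvariants_torsion_of_finrank_eq_one` — "`X(B)/I · X(B)` is not a torsion module" forces
  `X(B)_tor/I` finite —, Step 2 in the unsquared rational form, tree theorem
  `lengthAt_primeT_eq_zero_of_C_mul_charIdeal_le` — Greenberg's Lemma 4.2 `T ∤ char(X_tor)`, hence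
  `T ∤ char(S/Λκ)`), and the conclusion "the Heegner cohomology class corresponding to `P_{g,χ}` is
  non-trivial" in its three forms: `….pow_smul_notMem_TSubmodule_of_hmc` (`p^m κ ∉ TS`),
  `….C_smul_mkQ_ne_zero_of_hmc` (the class of `κ` in `S/IS` is not `ℤ_p`-torsion),
  `….pow_smul_specialization_ne_zero_of_hmc` (its image under any specialisation `S/IS → H` with
  `p`-power-torsion kernel — `H = H¹_f(K, V)` receiving the Kummer image of `P_{g,χ}` — is non-torsion).
* **Cor. 3.16, the cyclotomic derivative of the factorisation** (Leibniz at `S = 0` over the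
  anticyclotomic algebra): `BurungaleTian2019.coeff_one_mul_of_constantCoeff_eq_zero`,
  `….cyclotomicDerivative_eq_of_factorisation`, `….constantCoeff_eq_zero_of_factorisation`,
  `….span_cyclotomicDerivative_eq_of_factorisation` (the ideal form feeding `h316`).
* **General coefficients (rank-`d` forms, new module theory).**
  `IwasawaAlgebra.lengthAt_coinvariants_pi` (`ℓ_𝔭((Λ^d)_Γ) = d`),
  `….lengthAt_coinvariants_eq_finrank_of_isTorsionFree` (**`ℓ_𝔭(Q_Γ) = rank_Λ Q`** for finitely
  generated torsion-free `Q`: a free `F ≅ Λ^d ⊆ Q` with torsion cokernel `C`, the snake lemma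
  `0 = Q[T] → C[T] → F_Γ → Q_Γ → C_Γ → 0` and `ℓ_𝔭(C[T]) = ℓ_𝔭(C_Γ)`),
  `….finite_coinvariants_torsion_of_coinvariantsRank_le_finrank` (**Step 1, rank `d`**:
  `rank_{ℤ_p} X/TX ≤ rank_Λ X ⟹ X_tor/T X_tor` finite),
  `….pow_smul_notMem_TSubmodule_of_lengthAt_quotient_eq_zero` (**Step 3 for a Heegner MODULE
  `F ∋ κ`**: `(S/F)_𝔭 = 0` and "`κ̄ ∈ F/TF` not `ℤ_p`-torsion" give `p^m κ ∉ TS`, with no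
  torsion-freeness of `S`; `C_smul_mk_span_singleton_ne_zero` recovers the case `F = Λκ`), and the
  composed descent `….pow_smul_notMem_TSubmodule_of_hmc_of_coefficients` /
  `….pow_smul_specialization_ne_zero_of_hmc_of_coefficients`.
* **§4.2.3, Self-dual pair + Yuan–Zhang–Zhang + `L(E, s) = L(λ, s)`, the complex-analytic
  bookkeeping at `E`-level**: `BurungaleTian2019.analyticOrderNatAt_eq_of_eq_mul` (the order at `s₀`
  of `G · H` is that of `G` when `H(s₀) ≠ 0`) and `BurungaleTian2019.analyticRank_eq_one_of_selfDualPair`: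
  `W.analyticRank = 1` from `W.entireLFunction = L(λ, ·)` (Deuring; the character-free form is the
  tree theorem `Deuring_LFunction_baseChange_cmField_holds`), the factorisation
  `L(s, g × χ) = L(s, λ) · L(s, λ*χ/χ*)`, (4.3), and `ord_{s=1} L(s, g × χ) = 1` (Yuan–Zhang–Zhang
  [49, Thm. 1.2] applied to `P_{g,χ} ≠ 0`).
* **The composed skeleton** `BurungaleTian2019.analyticRank_eq_one_of_skeleton`: for one CM curve
  (any `W : WeierstrassCurve ℚ`) the conclusion `W.analyticRank = 1` from the skeleton data of the two
  bullets above and ONE arithmetic implication left as the hypothesis `hYZZ` — "the class of `κ`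
  specialises to a non-torsion element ⟹ `ord_{s=1} L(s, g × χ) = 1`" (Kummer injectivity on `B(K)`
  and Yuan–Zhang–Zhang, (GH1)–(GH2) being supplied by (4.2)–(4.3)). Composed with §3.4 this is the
  complete statement of what remains between the tree and `…_holds`: the objects themselves
  (`λ = λ_E`, `θ`, `B = A_g ⊗ χ`, `P_{g,χ}`, `S(·)`, `X(·)`, `κ`, Katz/Rankin–Selberg `p`-adic
  `L`-functions, `Λ`-adic heights), Prop. 4.2 (Rohrlich), Nekovář's parity (tree fact `p_parity`),
  Rubin's Thm. 11.1 (4.4) and [3, Prop. 4.3] (control), Disegni's Thm. C, the three `GL₁` main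
  conjectures, the regulator non-vanishing, Cor. 3.16, and Yuan–Zhang–Zhang — none of which is
  asserted here.

## References

* [BurungaleTian2019] A. A. Burungale, Y. Tian, Invent. Math. 220 (2020), 211–253: Thm. 1.2 (p. 214),
  Conj. 2.2 / Remark 2.3 (pp. 228–229), Thm. 3.2 (pp. 229–230), Lemma 3.7, Cor. 3.8, Prop. 3.9
  (pp. 234–236), §3.2.4 (regulators, p. 236), Cor. 3.16 (p. 241), §3.4 (pp. 242–244), Remark 3.17,
  Prop. 4.2 (p. 246), Thm. 4.4 (p. 248), §4.2.3 (pp. 249–250).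
* [BurungaleCastellaSkinnerTian2022] A. Burungale, F. Castella, C. Skinner, Y. Tian, Ann. Math. Qué.
  46 (2022), §1 (the inputs (1)–(4) of [12] = the source, restated).
* R. Greenberg, *Iwasawa theory for elliptic curves*, LNM 1716 (1999), §4 Lemma 4.2.
* X. Wan, Acta Math. Sin. (Engl. Ser.) 37 (2021), Thm. 3.17 (the descent paragraph whose module
  theory the sibling skeleton files prove).
-/

noncomputable section

open scoped Classical nonZeroDivisors

universe u v w

namespace Literature.NumberTheory.EllipticCurves

/-! ## §3.4 — HMC (ii) from the `GL₁` main conjectures: ideal arithmetic in a domain -/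

namespace BurungaleTian2019

section IdealArithmetic

variable {R : Type u} [CommRing R] [IsDomain R]

/-- Cancellation of a nonzero principal ideal in a domain: `A · (r) = B · (r)`, `r ≠ 0 ⟹ A = B`
(`Ideal.span_singleton_mul_right_inj`). [folklore] -/
theorem eq_of_mul_span_singleton_eq {A B : Ideal R} {r : R} (hr : r ≠ 0)
    (h : A * Ideal.span {r} = B * Ideal.span {r}) : A = B := by
  rw [mul_comm A, mul_comm B] at h
  exact (Ideal.span_singleton_mul_right_inj hr).mp h

omit [IsDomain R] in
/-- **"Non-vanishing of the anticyclotomic regulator `R(λ)` follows from that of `L'_Σ(λ)`"**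
(p. 244): if `(L₁) = C_λ · R_λ` (IMC'2) and `L₁ ≠ 0` then `R_λ ≠ 0`.
[cite: BurungaleTian2019, §3.4 (p. 244), (IMC'2) (p. 243)] -/
theorem ne_bot_of_span_singleton_eq_mul {Clam Rlam : Ideal R} {L₁ : R} (hL₁ : L₁ ≠ 0)
    (hIMC' : Ideal.span {L₁} = Clam * Rlam) : Rlam ≠ ⊥ := by
  rintro rfl
  rw [Ideal.mul_bot, Ideal.span_singleton_eq_bot] at hIMC'
  exact hL₁ hIMC'

/-- **Burungale–Tian 2020, proof of Thm. 3.2, HMC (ii) (§3.4, pp. 243–244): the Heegner main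
conjecture in the CM case from the `GL₁` main conjectures — the ideal arithmetic.** In a commutative
domain `R` (the source's `Λ`, "the rational version", where `≐` is an equality of ideals) let
* (3.4) `(L'_p(g × χ)) = A · Aι · R_g` — Disegni's `Λ`-adic Gross–Zagier formula [18, Thm. C] for the
  non-torsion class `κ` in the rank-one torsion-free `S(B)`, `A = Char_Λ S(B)/(κ)`, `Aι = A^ι`,
  `R_g = R(g × χ)` the `Λ`-adic regulator;
* (IMC'2) `(L'_Σ(λ)) = C_λ · R_λ` — Agboola–Howard [2, Thm. A] and Arnold [3, Thm. 2.14 & 4.17],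
  `C_λ = Char_Λ X(λ)_tor`, `R_λ = R(λ)`;
* (IMC2) `(L⁻_Σ*(ψ*χ)) = C_ψ` — Rubin [38, Thm. 4.1], `C_ψ = Char_Λ X(ψ*χ)`;
* Cor. 3.16: `(L'_p(g × χ)) = (L'_Σ(λ)) · (L⁻_Σ*(ψ*χ))`;
* Lemma 3.7 + Cor. 3.8 (with (IMC1): `X(ψ*χ)` is torsion): `C_tor = C_λ · C_ψ`,
  `C_tor = Char(X(B)_tor)`;
* (3.6): `R_g = R_λ = (r)` with `r ≠ 0`.
Then **`A · Aι = C_tor`**, i.e. `Char_Λ S(B)/(κ) · Char_Λ (S(B)/(κ))^ι = Char(X(B)_tor)`: indeed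
`A · Aι · (r) = (L'_p) = (L'_Σ(λ)) · (L⁻(ψ*χ)) = C_λ · (r) · C_ψ = C_tor · (r)`, and `(r) ≠ 0` cancels.
[cite: BurungaleTian2019, Thm. 3.2 (ii) and its proof, §3.4 (pp. 243–244), with (3.4), (3.5), (3.6), Cor. 3.16, Lemma 3.7, Cor. 3.8] -/
theorem charIdeal_mul_conj_eq_of_gl1MainConjectures
    {A Aι Rg Rlam Clam Cψ Ctor : Ideal R} {Lp L₁ L₂ r : R}
    (h34 : Ideal.span {Lp} = A * Aι * Rg)
    (hIMC' : Ideal.span {L₁} = Clam * Rlam)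
    (hIMC : Ideal.span {L₂} = Cψ)
    (h316 : Ideal.span {Lp} = Ideal.span {L₁} * Ideal.span {L₂})
    (h38 : Ctor = Clam * Cψ)
    (h36 : Rg = Rlam) (hRlam : Rlam = Ideal.span {r}) (hr : r ≠ 0) :
    A * Aι = Ctor := by
  apply eq_of_mul_span_singleton_eq hr
  calc A * Aι * Ideal.span {r} = Ideal.span {Lp} := by rw [h34, h36, hRlam]
    _ = Clam * Rlam * Cψ := by rw [h316, hIMC', hIMC]
    _ = Ctor * Ideal.span {r} := by rw [h38, hRlam]; ring

end IdealArithmetic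

section OverLambda

variable (p : ℕ) [Fact p.Prime]

/-- **The same over `Λ = ℤ_[p]⟦T⟧`, with the regulator as printed**: "the regulator of a `Λ`-adic
height pairing is nothing but the characteristic ideal of its cokernel viewed as a `Λ`-module"
(§3.2.4, [2, Def. 3.1.3]) — so `R_λ = char_Λ(Cok)` for a finitely generated `Λ`-module `Cok`, a
PRINCIPAL ideal (tree theorem `charIdeal_isPrincipal_holds`), nonzero as soon as `L'_Σ(λ) ≠ 0`
("non-vanishing of `R(λ)` follows from that of `L'_Σ(λ)`", (IMC'2)). Conclusion as in
`charIdeal_mul_conj_eq_of_gl1MainConjectures`. [cite: BurungaleTian2019, §3.4 (pp. 243–244) and §3.2.4 (p. 236)] -/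
theorem charIdeal_mul_conj_eq_of_gl1MainConjectures_of_regulator
    {Cok : Type v} [AddCommGroup Cok] [Module (IwasawaAlgebra p) Cok]
    [Module.Finite (IwasawaAlgebra p) Cok]
    {A Aι Rg Clam Cψ Ctor : Ideal (IwasawaAlgebra p)} {Lp L₁ L₂ : IwasawaAlgebra p}
    (h34 : Ideal.span {Lp} = A * Aι * Rg)
    (hIMC' : Ideal.span {L₁} = Clam * Module.charIdeal (IwasawaAlgebra p) Cok)
    (hIMC : Ideal.span {L₂} = Cψ)
    (h316 : Ideal.span {Lp} = Ideal.span {L₁} * Ideal.span {L₂})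
    (h38 : Ctor = Clam * Cψ)
    (h36 : Rg = Module.charIdeal (IwasawaAlgebra p) Cok) (hL₁ : L₁ ≠ 0) :
    A * Aι = Ctor := by
  obtain ⟨r, hr⟩ := (charIdeal_isPrincipal_holds p Cok).principal
  have hr' : Module.charIdeal (IwasawaAlgebra p) Cok = Ideal.span {r} := hr
  have hr0 : r ≠ 0 := by
    intro h0
    apply ne_bot_of_span_singleton_eq_mul hL₁ hIMC'
    rw [hr', h0, Ideal.span_singleton_eq_bot]
  exact charIdeal_mul_conj_eq_of_gl1MainConjectures h34 hIMC' hIMC h316 h38 h36 hr' hr0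

end OverLambda

end BurungaleTian2019

/-! ## Lemma 3.7 / Cor. 3.8 / Prop. 3.9 — the module theory of the Selmer decomposition -/

namespace BurungaleTian2019

section Decomposition

variable {R : Type u} [CommRing R]
variable {M₁ : Type v} {M₂ : Type v} [AddCommGroup M₁] [Module R M₁] [AddCommGroup M₂] [Module R M₂]

/-- A direct sum of two torsion modules is torsion. [folklore] -/
theorem isTorsion_prod (h₁ : Module.IsTorsion R M₁) (h₂ : Module.IsTorsion R M₂) :
    Module.IsTorsion R (M₁ × M₂) := by
  intro x
  obtain ⟨a, ha⟩ := @h₁ x.1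
  obtain ⟨b, hb⟩ := @h₂ x.2
  refine ⟨b * a, Prod.ext ?_ ?_⟩
  · change ((b * a : R⁰) : R) • x.1 = 0
    rw [Submonoid.coe_mul, mul_smul]
    change (b : R) • ((a : R⁰) • x.1) = 0
    rw [ha, smul_zero]
  · change ((b * a : R⁰) : R) • x.2 = 0
    rw [Submonoid.coe_mul, mul_comm, mul_smul]
    change (a : R) • ((b : R⁰) • x.2) = 0
    rw [hb, smul_zero]

/-- A direct sum of two torsion-free modules is torsion-free ("Torsion-free. In view of Lemma 3.7, it
suffices to show that the `GL₁/K`-Selmer groups `S(λ)` and `S(ψ*χ)` are `Λ`-torsion-free", p. 243).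
[cite: BurungaleTian2019, §3.4, proof of HMC (i) (p. 243)] -/
theorem noZeroSMulDivisors_prod [NoZeroSMulDivisors R M₁] [NoZeroSMulDivisors R M₂] :
    NoZeroSMulDivisors R (M₁ × M₂) := by
  refine ⟨fun {c x} h ↦ ?_⟩
  have h1 : c • x.1 = 0 := congrArg Prod.fst h
  have h2 : c • x.2 = 0 := congrArg Prod.snd h
  rcases NoZeroSMulDivisors.eq_zero_or_eq_zero_of_smul_eq_zero h1 with hc | hx1
  · exact Or.inl hc
  rcases NoZeroSMulDivisors.eq_zero_or_eq_zero_of_smul_eq_zero h2 with hc | hx2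
  · exact Or.inl hc
  exact Or.inr (Prod.ext hx1 hx2)

variable [IsDomain R]

/-- **Rank–nullity for a direct sum over a domain**: `rank (M₁ ⊕ M₂) = rank M₁ + rank M₂` for
finitely generated modules (no freeness: rank–nullity for the projection `M₁ ⊕ M₂ → M₁`,
`IsDomain.hasRankNullity`). [folklore] -/
theorem finrank_prod_eq_add [Module.Finite R M₁] [Module.Finite R M₂] :
    Module.finrank R (M₁ × M₂) = Module.finrank R M₁ + Module.finrank R M₂ := by
  have h := Submodule.finrank_quotient_add_finrank (LinearMap.ker (LinearMap.fst R M₁ M₂))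
  rw [LinearEquiv.finrank_eq
      ((LinearMap.fst R M₁ M₂).quotKerEquivOfSurjective LinearMap.fst_surjective),
    LinearMap.ker_fst, ← LinearEquiv.finrank_eq
      (LinearEquiv.ofInjective (LinearMap.inr R M₁ M₂) LinearMap.inr_injective)] at h
  exact h.symm

/-- **Prop. 3.9, the shape used for `X(B)`**: "the analogous result holds for the divisible Selmer
groups `X(·)`" — `rank_Λ X(B) = rank_Λ X(λ) + rank_Λ X(ψ*χ) = 1 + 0 = 1` along Lemma 3.7, `X(ψ*χ)`
being torsion ((IMC1), Rubin) and `X(λ)` of rank one ((IMC'1), Agboola–Howard/Arnold).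
[cite: BurungaleTian2019, Prop. 3.9 (pp. 235–236) with Lemma 3.7 (p. 234)] -/
theorem finrank_prod_eq_one_of_isTorsion [Module.Finite R M₁] [Module.Finite R M₂]
    (h₁ : Module.finrank R M₁ = 1) (h₂ : Module.IsTorsion R M₂) :
    Module.finrank R (M₁ × M₂) = 1 := by
  rw [finrank_prod_eq_add, h₁, Module.finrank_eq_zero_iff_isTorsion.mpr h₂]

/-- **Prop. 3.9, the shape used for `S(B)`**: `rank_Λ S(V ⊗ Λ) = rank_Λ S(L(λ) ⊗ Λ) + rank_Λ
S(L(ψ*χ) ⊗ Λ) = 1 + 0 = 1`. [cite: BurungaleTian2019, Prop. 3.9 (pp. 235–236) with Lemma 3.7 (p. 234)] -/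
theorem finrank_prod_eq_one_of_finrank_eq_zero [Module.Finite R M₁] [Module.Finite R M₂]
    (h₁ : Module.finrank R M₁ = 1) (h₂ : Module.finrank R M₂ = 0) :
    Module.finrank R (M₁ × M₂) = 1 := by
  rw [finrank_prod_eq_add, h₁, h₂]

variable [IsNoetherianRing R]

/-- **`char(M₁ ⊕ M₂) = char(M₁) · char(M₂)`** for finitely generated torsion modules over a
Noetherian domain (the tree's multiplicativity of the characteristic ideal in the split short exact
sequence `0 → M₁ → M₁ ⊕ M₂ → M₂ → 0`, `Module.charIdeal_eq_mul_of_exact`). [folklore] -/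
theorem charIdeal_prod [Module.Finite R M₁] [Module.Finite R M₂]
    (h₁ : Module.IsTorsion R M₁) (h₂ : Module.IsTorsion R M₂) :
    Module.charIdeal R (M₁ × M₂) = Module.charIdeal R M₁ * Module.charIdeal R M₂ :=
  Module.charIdeal_eq_mul_of_exact (isTorsion_prod h₁ h₂) (LinearMap.inl R M₁ M₂)
    (LinearMap.snd R M₁ M₂) LinearMap.inl_injective LinearMap.snd_surjective .inl_snd

/-- **Cor. 3.8: `Char (M₁ ⊕ M₂)_tor = Char (M₁)_tor · Char (M₂)_tor`** ("`Char_Λ X(W)_tor =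
Char_Λ X(λ)_tor · Char_Λ X(ψ*χ)_tor`"), for finitely generated `M₁`, `M₂` over a Noetherian domain:
the torsion submodules sit in the short exact sequence `0 → (M₁)_tor → (M₁ ⊕ M₂)_tor → (M₂)_tor → 0`
(restrictions of `inl` and `snd`; a torsion element `(m₁, m₂)` has torsion components, and
`(0, t₂)` is torsion for `t₂` torsion), and the characteristic ideal is multiplicative.
[cite: BurungaleTian2019, Cor. 3.8 (p. 235)] -/
theorem charIdeal_torsion_prod [Module.Finite R M₁] [Module.Finite R M₂] :
    Module.charIdeal R (Submodule.torsion R (M₁ × M₂)) =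
      Module.charIdeal R (Submodule.torsion R M₁) * Module.charIdeal R (Submodule.torsion R M₂) := by
  haveI : IsNoetherian R (M₁ × M₂) := isNoetherian_of_isNoetherianRing_of_finite R _
  -- `inl` and `snd` restrict to the torsion submodules
  have hf_mem : ∀ x : M₁, x ∈ Submodule.torsion R M₁ →
      LinearMap.inl R M₁ M₂ x ∈ Submodule.torsion R (M₁ × M₂) := by
    intro x hx
    obtain ⟨a, ha⟩ := (Submodule.mem_torsion_iff x).mp hx
    exact (Submodule.mem_torsion_iff _).mpr ⟨a, Prod.ext ha (smul_zero _)⟩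
  have hg_mem : ∀ x : M₁ × M₂, x ∈ Submodule.torsion R (M₁ × M₂) →
      LinearMap.snd R M₁ M₂ x ∈ Submodule.torsion R M₂ := by
    intro x hx
    obtain ⟨a, ha⟩ := (Submodule.mem_torsion_iff x).mp hx
    exact (Submodule.mem_torsion_iff _).mpr ⟨a, congrArg Prod.snd ha⟩
  refine Module.charIdeal_eq_mul_of_exact (Submodule.torsion_isTorsion (R := R) (M := M₁ × M₂))
    ((LinearMap.inl R M₁ M₂).restrict hf_mem) ((LinearMap.snd R M₁ M₂).restrict hg_mem) ?_ ?_ ?_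
  · -- `0 → (M₁)_tor → (M₁ ⊕ M₂)_tor` is injective
    intro x y hxy
    apply Subtype.ext
    exact congrArg (fun z : Submodule.torsion R (M₁ × M₂) ↦ (z : M₁ × M₂).1) hxy
  · -- `(M₁ ⊕ M₂)_tor → (M₂)_tor → 0` is surjective: `(0, t)` is torsion
    intro t
    obtain ⟨a, ha⟩ := (Submodule.mem_torsion_iff (t : M₂)).mp t.2
    have hmem : ((0 : M₁), (t : M₂)) ∈ Submodule.torsion R (M₁ × M₂) :=
      (Submodule.mem_torsion_iff _).mpr ⟨a, Prod.ext (smul_zero _) ha⟩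
    exact ⟨⟨_, hmem⟩, Subtype.ext rfl⟩
  · -- exactness in the middle: a torsion `(m₁, 0)` has `m₁` torsion
    intro y
    constructor
    · intro hy
      have hy2 : (y : M₁ × M₂).2 = 0 :=
        congrArg (fun z : Submodule.torsion R M₂ ↦ (z : M₂)) hy
      have hy1 : (y : M₁ × M₂).1 ∈ Submodule.torsion R M₁ := by
        obtain ⟨a, ha⟩ := (Submodule.mem_torsion_iff (y : M₁ × M₂)).mp y.2
        exact (Submodule.mem_torsion_iff _).mpr ⟨a, congrArg Prod.fst ha⟩
      exact ⟨⟨_, hy1⟩, Subtype.ext (Prod.ext rfl hy2.symm)⟩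
    · rintro ⟨x, rfl⟩
      exact Subtype.ext rfl

/-- **Cor. 3.8 as used in §3.4**: if `M₂` is torsion ((IMC1): "`X(ψ*χ)` has `Λ`-rank zero", i.e.
is torsion) then `Char (M₁ ⊕ M₂)_tor = Char (M₁)_tor · Char M₂` — "`Char(X(B)_tor) = Char_Λ X(λ)_tor ·
Char_Λ X(ψ*χ)`", the right-hand side of (3.5) without the regulator.
[cite: BurungaleTian2019, Cor. 3.8 (p. 235) and §3.4 (pp. 243–244)] -/
theorem charIdeal_torsion_prod_of_isTorsion [Module.Finite R M₁] [Module.Finite R M₂]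
    (h₂ : Module.IsTorsion R M₂) :
    Module.charIdeal R (Submodule.torsion R (M₁ × M₂)) =
      Module.charIdeal R (Submodule.torsion R M₁) * Module.charIdeal R M₂ := by
  have htop : Submodule.torsion R M₂ = ⊤ :=
    eq_top_iff.mpr fun x _ ↦ (Submodule.mem_torsion_iff x).mpr (@h₂ x)
  have e : Submodule.torsion R M₂ ≃ₗ[R] M₂ := LinearEquiv.ofTop _ htop
  have hchar : Module.charIdeal R (Submodule.torsion R M₂) = Module.charIdeal R M₂ := by
    unfold Module.charIdeal
    exact finprod_congr fun 𝔭 ↦ finprod_congr fun _ ↦ by rw [Module.lengthAt_eq_of_linearEquiv e]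
  rw [charIdeal_torsion_prod, hchar]

end Decomposition

end BurungaleTian2019

/-! ## §4.2.3 — Descent of HMC (4.5) along (4.6): the `Λ`-module skeleton -/

namespace IwasawaAlgebra

variable (p : ℕ) [Fact p.Prime]

/-- **(4.5) ⟹ the inclusion the descent uses.** From the Heegner main conjecture in the product
form of Thm. 3.2 (ii), "the rational version" with denominators cleared,
`c₁ · (A · Aι) = c₂ · C` (`A = Char_Λ S(B)/(κ)`, `Aι = A^ι`, `C = Char(X(B)_tor)`, `cᵢ ∈ ℤ_p`), the
unsquared rational inclusion `c₂ · C ⊆ A`. Nothing about the involution `ι` is used.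
[cite: BurungaleTian2019, Thm. 3.2 (ii) (p. 229) = (4.5) (p. 250)] -/
theorem span_C_mul_le_of_hmc {A Aι C : Ideal (IwasawaAlgebra p)} {c₁ c₂ : ℤ_[p]}
    (h : Ideal.span {(PowerSeries.C c₁ : IwasawaAlgebra p)} * (A * Aι) =
      Ideal.span {(PowerSeries.C c₂ : IwasawaAlgebra p)} * C) :
    Ideal.span {(PowerSeries.C c₂ : IwasawaAlgebra p)} * C ≤ A := by
  rw [← h, ← mul_assoc]
  exact Ideal.mul_le_right.trans Ideal.mul_le_left

/-- **Burungale–Tian 2020, §4.2.3, "Descent": `(S(B)/Λκ)_𝔭 = 0` at `𝔭 = (T)`.** Over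
`Λ = ℤ_[p]⟦T⟧` let `S` be finitely generated, torsion-free, of rank one ("`S(B)` is `Λ`-torsion-free
[…] `rank_Λ S(B) = 1`", HMC (i), proved §3.4 p. 243) and `κ ∈ S` nonzero (the `Λ`-adic Heegner
class, "`Λ`-non-torsion", HMC (i)); `X` finitely generated of rank one ("The Iwasawa module `X(B)`
has `Λ`-rank one (Proposition 3.9)") with torsion submodule `X_tor`; assume (4.5) with denominators
cleared, `c₁ · (Char(S/Λκ) · Aι) = c₂ · Char(X_tor)`, `c₂ ≠ 0`, and `rank_{ℤ_p} X/TX ≤ 1` — the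
control (4.6) "`X(B)/I · X(B) → Sel_{p^∞}(B/K)^∨ ⊗ L` with finite kernel and cokernel" together with
"`corank_L (Sel_{p^∞}(B/K) ⊗ L) = 1`" ((4.4) + Lemma 3.7). Then `ℓ_𝔭(S/Λκ) = 0`: `X_tor/I` is finite
(Step 1 in Howard's shape, `finite_coinvariants_torsion_of_finrank_eq_one`), so `T ∤ char(X_tor)`
(Greenberg's Lemma 4.2) and by (4.5) `T ∤ char(S/Λκ)` (`lengthAt_primeT_eq_zero_of_C_mul_charIdeal_le`).
[cite: BurungaleTian2019, §4.2.3, proof of Thm. 4.4, "Heegner main conjecture" and "Descent" (p. 250)] -/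
theorem lengthAt_quotient_span_singleton_eq_zero_of_hmc {S : Type u} {X : Type v}
    [AddCommGroup S] [Module (IwasawaAlgebra p) S] [Module.Finite (IwasawaAlgebra p) S]
    [NoZeroSMulDivisors (IwasawaAlgebra p) S]
    [AddCommGroup X] [Module (IwasawaAlgebra p) X] [Module.Finite (IwasawaAlgebra p) X]
    (hS1 : Module.finrank (IwasawaAlgebra p) S = 1) {κ : S} (hκ : κ ≠ 0)
    (hX1 : Module.finrank (IwasawaAlgebra p) X = 1)
    {Aι : Ideal (IwasawaAlgebra p)} {c₁ c₂ : ℤ_[p]} (hc₂ : c₂ ≠ 0)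
    (hHMC : Ideal.span {(PowerSeries.C c₁ : IwasawaAlgebra p)} *
        (Module.charIdeal (IwasawaAlgebra p) (S ⧸ Submodule.span (IwasawaAlgebra p) {κ}) * Aι) =
      Ideal.span {(PowerSeries.C c₂ : IwasawaAlgebra p)} *
        Module.charIdeal (IwasawaAlgebra p) (Submodule.torsion (IwasawaAlgebra p) X))
    (hX : coinvariantsRank p X ≤ 1) :
    Module.lengthAt (IwasawaAlgebra p) (S ⧸ Submodule.span (IwasawaAlgebra p) {κ}) (primeT p) = 0 :=
  lengthAt_primeT_eq_zero_of_C_mul_charIdeal_le p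
    (Submodule.torsion_isTorsion (R := IwasawaAlgebra p) (M := X))
    (isTorsion_quotient_span_singleton_of_finrank_eq_one p hS1 hκ)
    (finite_coinvariants_torsion_of_finrank_eq_one p hX1 hX) hc₂ (span_C_mul_le_of_hmc p hHMC)

/-- **The descent, first form: `p^m κ ∉ TS` for every `m`** — under (4.5), (4.6) and
`corank = 1` as in `lengthAt_quotient_span_singleton_eq_zero_of_hmc`, the Heegner class `κ` does not
become `ℤ_p`-torsion in `S/IS` ("In view of HMC (4.5), it now follows that the Heegner cohomology
class corresponding to the Heegner point `P_{g,χ}` is non-trivial", p. 250; Step 3 of the tree's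
descent, `pow_smul_notMem_TSubmodule_of_lengthAt_eq_zero`).
[cite: BurungaleTian2019, §4.2.3, proof of Thm. 4.4, "Descent" (p. 250)] -/
theorem pow_smul_notMem_TSubmodule_of_hmc {S : Type u} {X : Type v}
    [AddCommGroup S] [Module (IwasawaAlgebra p) S] [Module.Finite (IwasawaAlgebra p) S]
    [NoZeroSMulDivisors (IwasawaAlgebra p) S]
    [AddCommGroup X] [Module (IwasawaAlgebra p) X] [Module.Finite (IwasawaAlgebra p) X]
    (hS1 : Module.finrank (IwasawaAlgebra p) S = 1) {κ : S} (hκ : κ ≠ 0)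
    (hX1 : Module.finrank (IwasawaAlgebra p) X = 1)
    {Aι : Ideal (IwasawaAlgebra p)} {c₁ c₂ : ℤ_[p]} (hc₂ : c₂ ≠ 0)
    (hHMC : Ideal.span {(PowerSeries.C c₁ : IwasawaAlgebra p)} *
        (Module.charIdeal (IwasawaAlgebra p) (S ⧸ Submodule.span (IwasawaAlgebra p) {κ}) * Aι) =
      Ideal.span {(PowerSeries.C c₂ : IwasawaAlgebra p)} *
        Module.charIdeal (IwasawaAlgebra p) (Submodule.torsion (IwasawaAlgebra p) X))
    (hX : coinvariantsRank p X ≤ 1) (m : ℕ) :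
    ((p : IwasawaAlgebra p) ^ m) • κ ∉ TSubmodule p S :=
  pow_smul_notMem_TSubmodule_of_lengthAt_eq_zero p hκ
    (lengthAt_quotient_span_singleton_eq_zero_of_hmc p hS1 hκ hX1 hc₂ hHMC hX) m

/-- **The descent, second form: the class of `κ` in the `Γ`-coinvariants `S/IS` is not
`ℤ_p`-torsion** — `c • (κ mod TS) ≠ 0` for every nonzero `c ∈ ℤ_p` (acting through `ℤ_p ⊂ Λ`).
[cite: BurungaleTian2019, §4.2.3, proof of Thm. 4.4, "Descent" (p. 250)] -/
theorem C_smul_mkQ_ne_zero_of_hmc {S : Type u} {X : Type v}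
    [AddCommGroup S] [Module (IwasawaAlgebra p) S] [Module.Finite (IwasawaAlgebra p) S]
    [NoZeroSMulDivisors (IwasawaAlgebra p) S]
    [AddCommGroup X] [Module (IwasawaAlgebra p) X] [Module.Finite (IwasawaAlgebra p) X]
    (hS1 : Module.finrank (IwasawaAlgebra p) S = 1) {κ : S} (hκ : κ ≠ 0)
    (hX1 : Module.finrank (IwasawaAlgebra p) X = 1)
    {Aι : Ideal (IwasawaAlgebra p)} {c₁ c₂ : ℤ_[p]} (hc₂ : c₂ ≠ 0)
    (hHMC : Ideal.span {(PowerSeries.C c₁ : IwasawaAlgebra p)} *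
        (Module.charIdeal (IwasawaAlgebra p) (S ⧸ Submodule.span (IwasawaAlgebra p) {κ}) * Aι) =
      Ideal.span {(PowerSeries.C c₂ : IwasawaAlgebra p)} *
        Module.charIdeal (IwasawaAlgebra p) (Submodule.torsion (IwasawaAlgebra p) X))
    (hX : coinvariantsRank p X ≤ 1) {c : ℤ_[p]} (hc : c ≠ 0) :
    (PowerSeries.C c : IwasawaAlgebra p) • (Submodule.Quotient.mk κ : coinvariants p S) ≠ 0 :=
  C_smul_mkQ_ne_zero_of_lengthAt_eq_zero p hκ
    (lengthAt_quotient_span_singleton_eq_zero_of_hmc p hS1 hκ hX1 hc₂ hHMC hX) hc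

/-- **The descent, third form — "the Heegner cohomology class corresponding to the Heegner point
`P_{g,χ}` is non-trivial"**: if moreover `sp : S/IS → H` is additive with `p`-power-torsion kernel
(the specialisation of `S(B)` at the trivial character into `H = H¹_f(K, V)`, an injection after
`⊗ ℚ_p`, carrying `κ` to the Kummer image `κ₀` of `P_{g,χ}`), then `p^m • κ₀ ≠ 0` for every `m`;
by injectivity of the Kummer map on `B(K) ⊗ ℚ_p`, `P_{g,χ} ≠ 0` in `B(K)_ℚ`, and Yuan–Zhang–Zhang
[49, Thm. 1.2] turns this into `ord_{s=1} L(s, g × χ) = 1` (hypothesis `hYZZ` of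
`BurungaleTian2019.analyticRank_eq_one_of_skeleton`).
[cite: BurungaleTian2019, §4.2.3, proof of Thm. 4.4, last paragraph (p. 250)] -/
theorem pow_smul_specialization_ne_zero_of_hmc {S : Type u} {X : Type v} {H : Type*}
    [AddCommGroup S] [Module (IwasawaAlgebra p) S] [Module.Finite (IwasawaAlgebra p) S]
    [NoZeroSMulDivisors (IwasawaAlgebra p) S]
    [AddCommGroup X] [Module (IwasawaAlgebra p) X] [Module.Finite (IwasawaAlgebra p) X]
    [AddCommGroup H]
    (hS1 : Module.finrank (IwasawaAlgebra p) S = 1) {κ : S} (hκ : κ ≠ 0)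
    (hX1 : Module.finrank (IwasawaAlgebra p) X = 1)
    {Aι : Ideal (IwasawaAlgebra p)} {c₁ c₂ : ℤ_[p]} (hc₂ : c₂ ≠ 0)
    (hHMC : Ideal.span {(PowerSeries.C c₁ : IwasawaAlgebra p)} *
        (Module.charIdeal (IwasawaAlgebra p) (S ⧸ Submodule.span (IwasawaAlgebra p) {κ}) * Aι) =
      Ideal.span {(PowerSeries.C c₂ : IwasawaAlgebra p)} *
        Module.charIdeal (IwasawaAlgebra p) (Submodule.torsion (IwasawaAlgebra p) X))
    (hX : coinvariantsRank p X ≤ 1)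
    (sp : coinvariants p S →+ H) (hsp : ∀ x, sp x = 0 → ∃ n : ℕ, p ^ n • x = 0) (m : ℕ) :
    p ^ m • sp (Submodule.Quotient.mk κ) ≠ 0 :=
  pow_smul_specialization_ne_zero_of_lengthAt_eq_zero p hκ
    (lengthAt_quotient_span_singleton_eq_zero_of_hmc p hS1 hκ hX1 hc₂ hHMC hX) sp hsp m

end IwasawaAlgebra

/-! ## §4.2.3 — "Self-dual pair", Yuan–Zhang–Zhang and `L(E, s) = L(λ, s)`: the `E`-level end -/

namespace BurungaleTian2019

open Filter Topology

/-- **The order at `z` of `G · H` is the order of `G` when `H` is analytic and non-vanishing at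
`z`** (additivity of the analytic order, `analyticOrderAt_mul`, and `ord_z H = 0`). This is the
content of "By (4.3), we thus have `ord_{s=1} L(s, λ) = 1 ⟺ ord_{s=1} L(s, g × χ) = 1`" for the
factorisation `L(s, g × χ) = L(s, λ) · L(s, λ*χ/χ*)`. [cite: BurungaleTian2019, §4.2.3, "Self-dual pair" (p. 249)] -/
theorem analyticOrderNatAt_eq_of_eq_mul {F G H : ℂ → ℂ} {z : ℂ} (hG : AnalyticAt ℂ G z)
    (hH : AnalyticAt ℂ H z) (hH0 : H z ≠ 0) (hF : F = G * H) :
    analyticOrderNatAt F z = analyticOrderNatAt G z := by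
  subst hF
  unfold analyticOrderNatAt
  rw [analyticOrderAt_mul hG hH, hH.analyticOrderAt_eq_zero.mpr hH0, add_zero]

/-- **§4.2.3 at `E`-level: `ord_{s=1} L(s, E/ℚ) = 1` from the self-dual pair.** For a Weierstrass
curve `W/ℚ` let `Llam`, `Lgχ`, `Ltw : ℂ → ℂ` stand for (the entire continuations of) `L(s, λ)`,
`L(s, g × χ)`, `L(s, λ*χ/χ*)`, with: `W.entireLFunction = Llam` ("`λ` [the] arithmetic Hecke character
over `K` […] corresponding to the CM modular form `f`", i.e. `L(s, E) = L(s, λ)`, Deuring — the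
character-free form is the tree theorem `Deuring_LFunction_baseChange_cmField_holds`); the
factorisation `Lgχ = Llam · Ltw` ("Self-dual pair"); `Ltw` analytic at `1` with `Ltw 1 ≠ 0` ((4.3),
Prop. 4.2 from Rohrlich); `Llam` analytic at `1`; and `ord_{s=1} Lgχ = 1` (Yuan–Zhang–Zhang
[49, Thm. 1.2] for the pair `(g, χ)` under (H), applied to `P_{g,χ} ≠ 0`). Then
`W.analyticRank = 1`. [cite: BurungaleTian2019, §4.2.3, proof of Thm. 4.4, "Self-dual pair" (p. 249)] -/
theorem analyticRank_eq_one_of_selfDualPair (W : WeierstrassCurve ℚ) {Llam Lgχ Ltw : ℂ → ℂ}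
    (hE : W.entireLFunction = Llam) (hfac : Lgχ = Llam * Ltw) (hLlam : AnalyticAt ℂ Llam 1)
    (hLtw : AnalyticAt ℂ Ltw 1) (h43 : Ltw 1 ≠ 0) (hGZ : analyticOrderNatAt Lgχ 1 = 1) :
    W.analyticRank = 1 := by
  unfold WeierstrassCurve.analyticRank
  rw [hE, ← analyticOrderNatAt_eq_of_eq_mul hLlam hLtw h43 hfac, hGZ]

/-- **Burungale–Tian 2020, Thm. 1.2 / Thm. 4.4 for one curve from the skeleton data (§4.2.3
composed).** For `W : WeierstrassCurve ℚ` (in the application a CM curve at a good ordinary `p > 3`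
with `corank_{ℤ_p} Sel_{p^∞}(E/ℚ) = 1`, hypotheses which the printed proof spends on producing the
data below: parity (4.2) and the twist (4.3) make `(g, χ)` a self-dual pair of root number `-1`, so
that `B`, `P_{g,χ}`, `κ` exist and Thm. 3.2 applies) and a prime `p`, suppose given over
`Λ = ℤ_[p]⟦T⟧`:
* `S` finitely generated torsion-free of rank one and `κ ∈ S` nonzero (`S(B)`, HMC (i));
  `X` finitely generated of rank one (`X(B)`, Prop. 3.9); (4.5) with denominators cleared for the
  pair `Char(S/Λκ)`, `Char(X_tor)` (Thm. 3.2 (ii) — itself the output of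
  `charIdeal_mul_conj_eq_of_gl1MainConjectures`); `rank_{ℤ_p} X/TX ≤ 1` ((4.6) + (4.4) + Lemma 3.7);
* a specialisation `sp : S/IS → H` with `p`-power-torsion kernel (into `H¹_f(K, V) ∋ κ₀`);
* entire functions with `W.entireLFunction = Llam`, `Lgχ = Llam · Ltw`, `Ltw 1 ≠ 0` ((4.3));
* `hYZZ`: if `p^m • sp (κ mod IS) ≠ 0` for all `m` (the Heegner class of `P_{g,χ}` is non-trivial,
  hence `P_{g,χ} ≠ 0` by Kummer injectivity) then `ord_{s=1} L(s, g × χ) = 1` (Yuan–Zhang–Zhang).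
Then `W.analyticRank = 1`. Everything named in parentheses is an INPUT of the printed proof that the
tree does not have; what the proof DOES with the inputs is the content of this file.
[cite: BurungaleTian2019, Thm. 1.2 (p. 214), Thm. 4.4 (p. 248), §4.2.3 (pp. 249–250), Thm. 3.2 (pp. 229–230)] -/
theorem analyticRank_eq_one_of_skeleton (W : WeierstrassCurve ℚ) (p : ℕ) [Fact p.Prime]
    {S : Type u} {X : Type v} {H : Type*}
    [AddCommGroup S] [Module (IwasawaAlgebra p) S] [Module.Finite (IwasawaAlgebra p) S]
    [NoZeroSMulDivisors (IwasawaAlgebra p) S]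
    [AddCommGroup X] [Module (IwasawaAlgebra p) X] [Module.Finite (IwasawaAlgebra p) X]
    [AddCommGroup H]
    (hS1 : Module.finrank (IwasawaAlgebra p) S = 1) {κ : S} (hκ : κ ≠ 0)
    (hX1 : Module.finrank (IwasawaAlgebra p) X = 1)
    {Aι : Ideal (IwasawaAlgebra p)} {c₁ c₂ : ℤ_[p]} (hc₂ : c₂ ≠ 0)
    (hHMC : Ideal.span {(PowerSeries.C c₁ : IwasawaAlgebra p)} *
        (Module.charIdeal (IwasawaAlgebra p) (S ⧸ Submodule.span (IwasawaAlgebra p) {κ}) * Aι) =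
      Ideal.span {(PowerSeries.C c₂ : IwasawaAlgebra p)} *
        Module.charIdeal (IwasawaAlgebra p) (Submodule.torsion (IwasawaAlgebra p) X))
    (hX : IwasawaAlgebra.coinvariantsRank p X ≤ 1)
    (sp : IwasawaAlgebra.coinvariants p S →+ H) (hsp : ∀ x, sp x = 0 → ∃ n : ℕ, p ^ n • x = 0)
    {Llam Lgχ Ltw : ℂ → ℂ}
    (hE : W.entireLFunction = Llam) (hfac : Lgχ = Llam * Ltw) (hLlam : AnalyticAt ℂ Llam 1)
    (hLtw : AnalyticAt ℂ Ltw 1) (h43 : Ltw 1 ≠ 0)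
    (hYZZ : (∀ m : ℕ, p ^ m • sp (Submodule.Quotient.mk κ) ≠ 0) → analyticOrderNatAt Lgχ 1 = 1) :
    W.analyticRank = 1 :=
  analyticRank_eq_one_of_selfDualPair W hE hfac hLlam hLtw h43
    (hYZZ (IwasawaAlgebra.pow_smul_specialization_ne_zero_of_hmc p hS1 hκ hX1 hc₂ hHMC hX sp hsp))

end BurungaleTian2019


/-! ## General coefficients `𝒪`: the descent after restriction of scalars (rank-`d` forms)

The source's modules are modules over `Λ_𝒪 = 𝒪⟦Γ_K^-⟧`, `𝒪 = 𝒪_L` the ring of integers of the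
`p`-adic coefficient field `L` of §3.2.1 (for Thm. 1.2 the auxiliary finite-order character `χ` of
Prop. 4.2 forces `[L : ℚ_p] = d > 1` in general). Restricting scalars along `Λ = ℤ_[p]⟦T⟧ ⊂ Λ_𝒪`
(`Λ_𝒪 ≅ Λ^d` free): `X(B)` becomes a finitely generated `Λ`-module of rank `d · 1 = d` with the same
torsion submodule and the same `X/TX` (now of `ℤ_p`-rank `d · 1 = d`); `S(B) ⊇ F := Λ_𝒪 · κ`, a
`Λ`-submodule with `S(B)/F` torsion and `F/TF ≅ 𝒪 · κ̄` torsion-free over `ℤ_p`; and the descended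
consequence of (4.5) used by the proof ("`X(B)_tor/I` finite ⟹ `(S(B)/F)/I` finite", Greenberg's
Lemma 4.2 over `Λ_𝒪`) is insensitive to the restriction. The theorems of this section are the
rank-`d` forms of Steps 1 and 3 of the descent that this dictionary requires; with them the
descent of §4.2.3 holds for every coefficient ring `𝒪` (the case `d = 1`, `F = Λκ` recovering the
theorems above). -/

namespace IwasawaAlgebra

variable (p : ℕ) [Fact p.Prime]

/-- `ℓ_𝔭(X_Γ) = ℓ_𝔭(Y_Γ)` along a `Λ`-linear equivalence (`𝔭 = (T)`). [folklore] -/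
theorem lengthAt_coinvariants_eq_of_linearEquiv {X : Type v} {Y : Type w}
    [AddCommGroup X] [Module (IwasawaAlgebra p) X] [AddCommGroup Y] [Module (IwasawaAlgebra p) Y]
    (e : X ≃ₗ[IwasawaAlgebra p] Y) :
    Module.lengthAt (IwasawaAlgebra p) (coinvariants p X) (primeT p) =
      Module.lengthAt (IwasawaAlgebra p) (coinvariants p Y) (primeT p) := by
  refine lengthAt_coinvariants_eq_of_finite_ker_coker p e.toLinearMap ?_ ?_
  · haveI : Subsingleton (LinearMap.ker e.toLinearMap) :=
      ⟨fun a b ↦ Subtype.ext (e.injective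
        ((LinearMap.mem_ker.mp a.2).trans (LinearMap.mem_ker.mp b.2).symm))⟩
    infer_instance
  · haveI : Subsingleton (Y ⧸ LinearMap.range e.toLinearMap) := by
      refine ⟨fun a b ↦ ?_⟩
      induction a using Submodule.Quotient.induction_on with
      | H a =>
        induction b using Submodule.Quotient.induction_on with
        | H b =>
          exact (Submodule.Quotient.eq _).mpr ⟨e.symm (a - b), by simp⟩
    infer_instance

/-- **`ℓ_𝔭((Λ^d)_Γ) = d`** at `𝔭 = (T)`: `Λ^{d+1} ≅ Λ ⊕ Λ^d` (`Fin.consLinearEquiv`), `Γ`-coinvariants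
of a direct sum (`lengthAt_coinvariants_prod`) and `ℓ_𝔭(Λ_Γ) = 1` (`lengthAt_coinvariants_self`).
[folklore] -/
theorem lengthAt_coinvariants_pi : ∀ d : ℕ,
    Module.lengthAt (IwasawaAlgebra p) (coinvariants p (Fin d → IwasawaAlgebra p)) (primeT p) = d
  | 0 => by
    haveI : Finite (coinvariants p (Fin 0 → IwasawaAlgebra p)) :=
      Finite.of_surjective _ (Submodule.mkQ_surjective _)
    rw [lengthAt_primeT_eq_zero_of_finite p (coinvariants p (Fin 0 → IwasawaAlgebra p)),
      Nat.cast_zero]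
  | d + 1 => by
    rw [lengthAt_coinvariants_eq_of_linearEquiv p
        (Fin.consLinearEquiv (IwasawaAlgebra p) (fun _ : Fin (d + 1) ↦ IwasawaAlgebra p)).symm,
      lengthAt_coinvariants_prod p (IwasawaAlgebra p) (Fin d → IwasawaAlgebra p),
      lengthAt_coinvariants_self p, lengthAt_coinvariants_pi d, Nat.cast_add, Nat.cast_one, add_comm]

/-- **`ℓ_𝔭(Q_Γ) = rank_Λ Q` for a finitely generated torsion-free `Λ`-module `Q`** (`𝔭 = (T)`; the
rank-`d` form of "a nonzero torsion-free module has infinite `Γ`-coinvariants",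
`one_le_lengthAt_coinvariants_of_isTorsionFree`). Choose `d = rank Q` linearly independent elements,
spanning a free `F ≅ Λ^d` with `C = Q/F` torsion; the snake lemma for multiplication by `T` on
`0 → F → Q → C → 0` reads `0 = Q[T] → C[T] → F_Γ → Q_Γ → C_Γ → 0` (`Q[T] = 0` as `Q` is
torsion-free), and `ℓ_𝔭(C[T]) = ℓ_𝔭(C_Γ)` for the finitely generated torsion `C`
(`lengthAt_invariants_eq_lengthAt_coinvariants`), whence `ℓ_𝔭(Q_Γ) = ℓ_𝔭(F_Γ) = d`
(`lengthAt_coinvariants_pi`). [folklore] -/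
theorem lengthAt_coinvariants_eq_finrank_of_isTorsionFree {Q : Type u} [AddCommGroup Q]
    [Module (IwasawaAlgebra p) Q] [Module.Finite (IwasawaAlgebra p) Q]
    [Module.IsTorsionFree (IwasawaAlgebra p) Q] :
    Module.lengthAt (IwasawaAlgebra p) (coinvariants p Q) (primeT p) =
      Module.finrank (IwasawaAlgebra p) Q := by
  set d := Module.finrank (IwasawaAlgebra p) Q with hd
  obtain ⟨v, hv⟩ := exists_linearIndependent_of_le_finrank (le_refl d)
  set F : Submodule (IwasawaAlgebra p) Q := Submodule.span (IwasawaAlgebra p) (Set.range v) with hFdef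
  -- `F ≅ Λ^d`, so `ℓ(F_Γ) = d` and `rank F = d`
  let e : (Fin d → IwasawaAlgebra p) ≃ₗ[IwasawaAlgebra p] F :=
    (Finsupp.linearEquivFunOnFinite (IwasawaAlgebra p) (IwasawaAlgebra p) (Fin d)).symm.trans
      hv.linearCombinationEquiv
  have hF : Module.lengthAt (IwasawaAlgebra p) (coinvariants p F) (primeT p) = d := by
    rw [← lengthAt_coinvariants_eq_of_linearEquiv p e, lengthAt_coinvariants_pi p d]
  have hfinF : Module.finrank (IwasawaAlgebra p) F = d := by
    rw [← e.finrank_eq, Module.finrank_fintype_fun_eq_card, Fintype.card_fin]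
  -- `C = Q/F` is torsion (rank `d - d = 0`)
  have hC : Module.IsTorsion (IwasawaAlgebra p) (Q ⧸ F) := by
    apply Module.finrank_eq_zero_iff_isTorsion.mp
    have h := Submodule.finrank_quotient_add_finrank F
    omega
  -- `Q[T] = 0`
  have hQT : ∀ x : invariants p Q, x = 0 := fun x ↦ by
    apply Subtype.ext
    have hx := (mem_invariants_iff p Q x.1).mp x.2
    exact (smul_eq_zero.mp hx).resolve_left PowerSeries.X_ne_zero
  -- the snake lemma for `×T` on `0 → F → Q → C → 0`
  have hsub := Submodule.subtype_injective F
  have hmkQ := Submodule.mkQ_surjective F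
  have hFQ : Function.Exact F.subtype F.mkQ := LinearMap.exact_subtype_mkQ F
  have hδ : Function.Injective (snakeDelta F.subtype F.mkQ hsub hmkQ hFQ) := by
    rw [injective_iff_map_eq_zero]
    intro z hz
    obtain ⟨x, rfl⟩ := ((exact_invariantsMap_snakeDelta F.subtype F.mkQ hsub hmkQ hFQ) z).mp hz
    rw [hQT x, map_zero]
  have hex₁ : Function.Exact (snakeDelta F.subtype F.mkQ hsub hmkQ hFQ)
      (coinvariantsMap F.subtype).rangeRestrict := by
    rw [LinearMap.exact_iff, LinearMap.ker_rangeRestrict]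
    exact (LinearMap.exact_iff.mp (exact_snakeDelta_coinvariantsMap F.subtype F.mkQ hsub hmkQ hFQ))
  have hex₂ : Function.Exact (LinearMap.range (coinvariantsMap F.subtype)).subtype
      (coinvariantsMap F.mkQ) := by
    rw [LinearMap.exact_iff, Submodule.range_subtype]
    exact LinearMap.exact_iff.mp (exact_coinvariantsMap F.subtype F.mkQ hmkQ hFQ)
  -- `ℓ(F_Γ) = ℓ(C[T]) + ℓ(im)` and `ℓ(Q_Γ) = ℓ(im) + ℓ(C_Γ)`, `ℓ(C[T]) = ℓ(C_Γ)`
  have h₁ := Module.lengthAt_eq_add_of_exact _ _ hδ (LinearMap.surjective_rangeRestrict _) hex₁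
    (primeT p)
  have h₂ := Module.lengthAt_eq_add_of_exact _ _ (Submodule.subtype_injective _)
    (coinvariantsMap_surjective F.mkQ hmkQ) hex₂ (primeT p)
  have h₃ := lengthAt_invariants_eq_lengthAt_coinvariants p (Q ⧸ F) hC
  rw [h₂, ← h₃, add_comm, ← h₁, hF]

/-- **Step 1, rank-`d` form ("`X(B)/I · X(B)` is not a torsion module" versus "`X(B)` has
`Λ`-rank one", after restriction of scalars from `Λ_𝒪`).** For a finitely generated `Λ`-module `X`
with `rank_{ℤ_p} X/TX ≤ rank_Λ X` — for `X = X(B)`: `rank_{ℤ_p} X(B)/I·X(B) = d · corank_𝒪 = d`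
((4.6) with (4.4) and Lemma 3.7) and `rank_Λ X(B) = d · rank_{Λ_𝒪} X(B) = d` (Prop. 3.9) — the
torsion submodule has FINITE `Γ`-coinvariants `X_tor/T X_tor`: with `Q = X/X_tor`,
`ℓ_𝔭((X_tor)_Γ) + ℓ_𝔭(Q_Γ) = rank_{ℤ_p} X/TX ≤ rank_Λ X = rank_Λ Q = ℓ_𝔭(Q_Γ)`
(`lengthAt_coinvariants_eq_finrank_of_isTorsionFree`).
[cite: BurungaleTian2019, §4.2.3, "Descent" (p. 250), with Prop. 3.9 (p. 235)] -/
theorem finite_coinvariants_torsion_of_coinvariantsRank_le_finrank {X : Type u} [AddCommGroup X]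
    [Module (IwasawaAlgebra p) X] [Module.Finite (IwasawaAlgebra p) X]
    (hX : coinvariantsRank p X ≤ Module.finrank (IwasawaAlgebra p) X) :
    Finite (coinvariants p (Submodule.torsion (IwasawaAlgebra p) X)) := by
  set Xt := Submodule.torsion (IwasawaAlgebra p) X with hXt
  have hQ : Module.finrank (IwasawaAlgebra p) (X ⧸ Xt) = Module.finrank (IwasawaAlgebra p) X := by
    have h := Submodule.finrank_quotient_add_finrank Xt
    rw [Module.finrank_eq_zero_iff_isTorsion.mpr
      (Submodule.torsion_isTorsion (R := IwasawaAlgebra p) (M := X)), add_zero] at h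
    exact h
  -- `(X_tor)_Γ → X_Γ` is injective (`t = Tx` forces `T x̄ = 0` in the torsion-free `X/X_tor`)
  have hinj : Function.Injective (coinvariantsMap Xt.subtype) := by
    rw [injective_iff_map_eq_zero]
    intro t ht
    induction t using Submodule.Quotient.induction_on with
    | H t =>
      rw [coinvariantsMap_mk, Submodule.Quotient.mk_eq_zero, mem_TSubmodule_iff] at ht
      obtain ⟨x, hx⟩ := ht
      rw [Submodule.Quotient.mk_eq_zero, mem_TSubmodule_iff]
      have hxQ : (PowerSeries.X : IwasawaAlgebra p) • (Xt.mkQ x) = 0 := by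
        rw [← map_smul, hx, Submodule.mkQ_apply, Submodule.Quotient.mk_eq_zero]
        exact t.2
      have hx0 : Xt.mkQ x = 0 := (smul_eq_zero.mp hxQ).resolve_left PowerSeries.X_ne_zero
      rw [Submodule.mkQ_apply, Submodule.Quotient.mk_eq_zero] at hx0
      refine ⟨⟨x, hx0⟩, Subtype.ext ?_⟩
      simpa using hx
  have hexact := exact_coinvariantsMap Xt.subtype Xt.mkQ (Submodule.mkQ_surjective _)
    (LinearMap.exact_subtype_mkQ Xt)
  have hlen := Module.lengthAt_eq_add_of_exact _ _ hinj
    (coinvariantsMap_surjective Xt.mkQ (Submodule.mkQ_surjective _)) hexact (primeT p)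
  rw [lengthAt_coinvariants_eq_coinvariantsRank p X,
    lengthAt_coinvariants_eq_finrank_of_isTorsionFree p (Q := X ⧸ Xt), hQ] at hlen
  set l := Module.lengthAt (IwasawaAlgebra p) (coinvariants p Xt) (primeT p) with hl
  have hne : l ≠ ⊤ :=
    Module.lengthAt_ne_top_of_isTorsionBy (s := (PowerSeries.X : IwasawaAlgebra p))
      PowerSeries.X_ne_zero (fun q ↦ X_smul_coinvariants p Xt q) (primeT p) (height_primeT p).le
  have h0 : l = 0 := by
    lift l to ℕ using hne with n hn
    have h' : coinvariantsRank p X = n + Module.finrank (IwasawaAlgebra p) X := by exact_mod_cast hlen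
    have : n = 0 := by omega
    simp [this]
  exact (finite_iff_lengthAt_eq_zero_of_X_smul_eq_zero p (coinvariants p Xt)
    (fun q ↦ X_smul_coinvariants p Xt q)).mpr h0

/-- **Step 3, general form: the class of `κ` stays non-torsion in `S/IS`.** Let `F ⊆ S` be a
`Λ`-submodule and `κ ∈ F` such that the class of `κ` in `F/TF` is not `ℤ_p`-torsion — for
`F = Λ_𝒪 · κ ≅ Λ_𝒪` (restriction of scalars; `κ` is `Λ_𝒪`-non-torsion in the `Λ_𝒪`-torsion-free
`S(B)`, HMC (i)) one has `F/TF ≅ 𝒪 · κ̄ ≅ 𝒪`, torsion-free over `ℤ_p` — and assume `(S/F)_𝔭 = 0`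
at `𝔭 = (T)` (the output of Step 2). Then `p^m κ ∉ TS` for every `m`: if `p^m κ = T σ`, some
`r ∉ (T)` has `r σ ∈ F`, so `(r p^m) κ = T (r σ) ∈ TF`, i.e. `r(0) p^m · κ̄ = 0` in `F/TF`
(`r` acts on `F/TF` through its constant term `r(0) ≠ 0`) — absurd. No torsion-freeness of `S` is
needed; for `F = Λκ` this is the tree's `pow_smul_notMem_TSubmodule_of_lengthAt_eq_zero`.
[cite: BurungaleTian2019, §4.2.3, "Descent" (p. 250)] -/
theorem pow_smul_notMem_TSubmodule_of_lengthAt_quotient_eq_zero {S : Type u} [AddCommGroup S]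
    [Module (IwasawaAlgebra p) S] (F : Submodule (IwasawaAlgebra p) S) {κ : S} (hκF : κ ∈ F)
    (hκ : ∀ c : ℤ_[p], c ≠ 0 →
      (PowerSeries.C c : IwasawaAlgebra p) • (Submodule.Quotient.mk ⟨κ, hκF⟩ : coinvariants p F) ≠ 0)
    (hSF : Module.lengthAt (IwasawaAlgebra p) (S ⧸ F) (primeT p) = 0) (m : ℕ) :
    ((p : IwasawaAlgebra p) ^ m) • κ ∉ TSubmodule p S := by
  intro hmem
  obtain ⟨σ, hσ⟩ := (mem_TSubmodule_iff p S _).mp hmem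
  -- `(S/F)_𝔭 = 0`: some `r ∉ (T)` pushes `σ` into `F`
  have hsub := (Module.lengthAt_eq_zero_iff (primeT p)).mp hSF
  obtain ⟨r, hr, hrσ⟩ := LocalizedModule.subsingleton_iff.mp hsub
    (Submodule.Quotient.mk σ : S ⧸ F)
  rw [← Submodule.Quotient.mk_smul, Submodule.Quotient.mk_eq_zero] at hrσ
  -- in `F`: `T • (r σ) = (r p^m) • κ`
  have hTF : ((r * (p : IwasawaAlgebra p) ^ m) • (⟨κ, hκF⟩ : F) : F) ∈ TSubmodule p F := by
    rw [mem_TSubmodule_iff]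
    refine ⟨⟨r • σ, hrσ⟩, Subtype.ext ?_⟩
    change (PowerSeries.X : IwasawaAlgebra p) • (r • σ) = (r * (p : IwasawaAlgebra p) ^ m) • κ
    rw [smul_smul, mul_comm, ← smul_smul, hσ, smul_smul]
  have h0 : (r * (p : IwasawaAlgebra p) ^ m) •
      (Submodule.Quotient.mk (⟨κ, hκF⟩ : F) : coinvariants p F) = 0 := by
    rw [← Submodule.Quotient.mk_smul, Submodule.Quotient.mk_eq_zero]
    exact hTF
  rw [smul_eq_C_smul_of_X_smul_eq_zero p (r * (p : IwasawaAlgebra p) ^ m)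
    (X_smul_coinvariants p F _)] at h0
  refine hκ (PowerSeries.constantCoeff (r * (p : IwasawaAlgebra p) ^ m)) ?_ h0
  rw [map_mul, map_pow, map_natCast]
  refine mul_ne_zero (fun hr0 ↦ hr ?_) (pow_ne_zero _ (NeZero.ne (p : ℤ_[p])))
  show r ∈ (primeT p).asIdeal
  rw [primeT_asIdeal, mem_span_X_iff]
  exact hr0

/-- The case `F = Λκ` of the non-torsion hypothesis: for `S` torsion-free and `κ ≠ 0`, the class
of `κ` in `Λκ/TΛκ ≅ ℤ_p` is not `ℤ_p`-torsion (`c κ = T a κ` forces `C c = T a`, so `c = 0`).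
So `pow_smul_notMem_TSubmodule_of_lengthAt_quotient_eq_zero` contains the tree's Step 3.
[folklore] -/
theorem C_smul_mk_span_singleton_ne_zero {S : Type u} [AddCommGroup S]
    [Module (IwasawaAlgebra p) S] [NoZeroSMulDivisors (IwasawaAlgebra p) S] {κ : S} (hκ : κ ≠ 0)
    {c : ℤ_[p]} (hc : c ≠ 0) :
    (PowerSeries.C c : IwasawaAlgebra p) •
      (Submodule.Quotient.mk ⟨κ, Submodule.mem_span_singleton_self κ⟩ :
        coinvariants p (Submodule.span (IwasawaAlgebra p) {κ})) ≠ 0 := by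
  intro h0
  rw [← Submodule.Quotient.mk_smul, Submodule.Quotient.mk_eq_zero, mem_TSubmodule_iff] at h0
  obtain ⟨y, hy⟩ := h0
  obtain ⟨a, ha⟩ := Submodule.mem_span_singleton.mp y.2
  have h := congrArg Subtype.val hy
  simp only [SetLike.val_smul] at h
  rw [← ha, smul_smul] at h
  -- `(T a) κ = (C c) κ` in the torsion-free `S`
  have h' : (PowerSeries.X * a - PowerSeries.C c : IwasawaAlgebra p) • κ = 0 := by
    rw [sub_smul, h, sub_self]
  have h'' : (PowerSeries.X * a - PowerSeries.C c : IwasawaAlgebra p) = 0 :=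
    (smul_eq_zero.mp h').resolve_right hκ
  have hcoeff := congrArg PowerSeries.constantCoeff h''
  rw [map_sub, map_mul, PowerSeries.constantCoeff_X, zero_mul, zero_sub, PowerSeries.constantCoeff_C,
    map_zero, neg_eq_zero] at hcoeff
  exact hc hcoeff

/-- `p^m • (κ mod TS) ≠ 0` from `p^m κ ∉ TS`. [folklore] -/
theorem pow_smul_mkQ_ne_zero_of_forall_notMem {S : Type u} [AddCommGroup S]
    [Module (IwasawaAlgebra p) S] {κ : S}
    (h : ∀ m : ℕ, ((p : IwasawaAlgebra p) ^ m) • κ ∉ TSubmodule p S) (m : ℕ) :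
    p ^ m • (Submodule.Quotient.mk κ : coinvariants p S) ≠ 0 := by
  intro h0
  apply h m
  rw [← Nat.cast_smul_eq_nsmul (IwasawaAlgebra p), ← Submodule.Quotient.mk_smul,
    Submodule.Quotient.mk_eq_zero, Nat.cast_pow] at h0
  exact h0

/-- Specialisation with `p`-power-torsion kernel preserves "`p^m • (κ mod TS) ≠ 0` for all `m`".
[folklore] -/
theorem pow_smul_specialization_ne_zero_of_forall_notMem {S : Type u} {H : Type*} [AddCommGroup S]
    [Module (IwasawaAlgebra p) S] [AddCommGroup H] {κ : S}
    (h : ∀ m : ℕ, ((p : IwasawaAlgebra p) ^ m) • κ ∉ TSubmodule p S)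
    (sp : coinvariants p S →+ H) (hsp : ∀ x, sp x = 0 → ∃ n : ℕ, p ^ n • x = 0) (m : ℕ) :
    p ^ m • sp (Submodule.Quotient.mk κ) ≠ 0 := by
  intro h0
  rw [← map_nsmul] at h0
  obtain ⟨n, hn⟩ := hsp _ h0
  rw [← mul_nsmul', ← pow_add] at hn
  exact pow_smul_mkQ_ne_zero_of_forall_notMem p h (n + m) hn

/-- **Burungale–Tian 2020, §4.2.3, the descent for coefficients `𝒪` (after restriction of scalars
to `Λ = ℤ_[p]⟦T⟧`).** Let `S`, `X` be finitely generated `Λ`-modules — `S(B)`, `X(B)` viewed over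
`Λ ⊂ Λ_𝒪` —, `F ⊆ S` a submodule with `S/F` torsion and `κ ∈ F` whose class in `F/TF` is not
`ℤ_p`-torsion — `F = Λ_𝒪 · κ`, "`rank_Λ S(B) = 1`" and "`κ` is `Λ`-non-torsion" (HMC (i)),
`F/TF ≅ 𝒪` —; assume (4.5) with denominators cleared for the pair `Char_Λ(S/F)`, `Char_Λ(X_tor)`
(the restriction to `Λ` of Thm. 3.2 (ii): characteristic ideals of restricted modules are the norms
of the `Λ_𝒪`-characteristic ideals, and the one consequence used — `T ∤ Char(X_tor) ⟹ T ∤ Char(S/F)`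
— is literally the same statement over `Λ` and over `Λ_𝒪`), and
`rank_{ℤ_p} X/TX ≤ rank_Λ X` ((4.6) + `corank_𝒪 = 1` give `ℤ_p`-rank `d`; Prop. 3.9 gives
`Λ`-rank `d`). Then `p^m κ ∉ TS` for every `m`.
[cite: BurungaleTian2019, §4.2.3, proof of Thm. 4.4, "Heegner main conjecture" and "Descent" (p. 250); §3.2.1 (coefficients `𝒪`, p. 230)] -/
theorem pow_smul_notMem_TSubmodule_of_hmc_of_coefficients {S : Type u} {X : Type v}
    [AddCommGroup S] [Module (IwasawaAlgebra p) S] [Module.Finite (IwasawaAlgebra p) S]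
    [AddCommGroup X] [Module (IwasawaAlgebra p) X] [Module.Finite (IwasawaAlgebra p) X]
    (F : Submodule (IwasawaAlgebra p) S) {κ : S} (hκF : κ ∈ F)
    (hκ : ∀ c : ℤ_[p], c ≠ 0 →
      (PowerSeries.C c : IwasawaAlgebra p) • (Submodule.Quotient.mk ⟨κ, hκF⟩ : coinvariants p F) ≠ 0)
    (hSF : Module.IsTorsion (IwasawaAlgebra p) (S ⧸ F))
    (hXrk : coinvariantsRank p X ≤ Module.finrank (IwasawaAlgebra p) X)
    {Aι : Ideal (IwasawaAlgebra p)} {c₁ c₂ : ℤ_[p]} (hc₂ : c₂ ≠ 0)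
    (hHMC : Ideal.span {(PowerSeries.C c₁ : IwasawaAlgebra p)} *
        (Module.charIdeal (IwasawaAlgebra p) (S ⧸ F) * Aι) =
      Ideal.span {(PowerSeries.C c₂ : IwasawaAlgebra p)} *
        Module.charIdeal (IwasawaAlgebra p) (Submodule.torsion (IwasawaAlgebra p) X))
    (m : ℕ) : ((p : IwasawaAlgebra p) ^ m) • κ ∉ TSubmodule p S :=
  haveI : IsNoetherian (IwasawaAlgebra p) X := isNoetherian_of_isNoetherianRing_of_finite _ _
  pow_smul_notMem_TSubmodule_of_lengthAt_quotient_eq_zero p F hκF hκ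
    (lengthAt_primeT_eq_zero_of_C_mul_charIdeal_le p
      (Submodule.torsion_isTorsion (R := IwasawaAlgebra p) (M := X)) hSF
      (finite_coinvariants_torsion_of_coinvariantsRank_le_finrank p hXrk) hc₂
      (span_C_mul_le_of_hmc p hHMC)) m

/-- **The descent for coefficients `𝒪`, specialised — "the Heegner cohomology class corresponding
to the Heegner point `P_{g,χ}` is non-trivial"**: in the situation of
`pow_smul_notMem_TSubmodule_of_hmc_of_coefficients`, for any additive `sp : S/IS → H` with
`p`-power-torsion kernel (the specialisation into `H¹_f(K, V)`), `p^m • sp (κ mod IS) ≠ 0` for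
every `m`. [cite: BurungaleTian2019, §4.2.3, proof of Thm. 4.4, last paragraph (p. 250)] -/
theorem pow_smul_specialization_ne_zero_of_hmc_of_coefficients {S : Type u} {X : Type v}
    {H : Type*}
    [AddCommGroup S] [Module (IwasawaAlgebra p) S] [Module.Finite (IwasawaAlgebra p) S]
    [AddCommGroup X] [Module (IwasawaAlgebra p) X] [Module.Finite (IwasawaAlgebra p) X]
    [AddCommGroup H]
    (F : Submodule (IwasawaAlgebra p) S) {κ : S} (hκF : κ ∈ F)
    (hκ : ∀ c : ℤ_[p], c ≠ 0 →
      (PowerSeries.C c : IwasawaAlgebra p) • (Submodule.Quotient.mk ⟨κ, hκF⟩ : coinvariants p F) ≠ 0)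
    (hSF : Module.IsTorsion (IwasawaAlgebra p) (S ⧸ F))
    (hXrk : coinvariantsRank p X ≤ Module.finrank (IwasawaAlgebra p) X)
    {Aι : Ideal (IwasawaAlgebra p)} {c₁ c₂ : ℤ_[p]} (hc₂ : c₂ ≠ 0)
    (hHMC : Ideal.span {(PowerSeries.C c₁ : IwasawaAlgebra p)} *
        (Module.charIdeal (IwasawaAlgebra p) (S ⧸ F) * Aι) =
      Ideal.span {(PowerSeries.C c₂ : IwasawaAlgebra p)} *
        Module.charIdeal (IwasawaAlgebra p) (Submodule.torsion (IwasawaAlgebra p) X))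
    (sp : coinvariants p S →+ H) (hsp : ∀ x, sp x = 0 → ∃ n : ℕ, p ^ n • x = 0) (m : ℕ) :
    p ^ m • sp (Submodule.Quotient.mk κ) ≠ 0 :=
  pow_smul_specialization_ne_zero_of_forall_notMem p
    (pow_smul_notMem_TSubmodule_of_hmc_of_coefficients p F hκF hκ hSF hXrk hc₂ hHMC) sp hsp m

end IwasawaAlgebra


/-! ## Cor. 3.16 — the cyclotomic derivative of a factorisation (Leibniz at `S = 0`)

"In view of the hypothesis `ε(g × χ) = ε(1/2, λ) = -1`, we have `L⁻_p(g × χ) = L⁻_Σ(λ) = 0` as the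
interpolated central `L`-values vanish identically […]. From Lemma 3.14 [`L_p(g × χ) ≐ L_Σ(λ) ·
L_Σ*(ψ*χ)`], this finishes the proof." (p. 241), where `L'_□ = d/dS L_□ |_{S=0}` is the cyclotomic
derivative and `L⁻_□ = L_□ |_{S=0}` the anticyclotomic projection, `S` being the cyclotomic
variable: writing the two-variable `p`-adic `L`-functions as power series in `S` over the
anticyclotomic algebra `A`, this is the Leibniz rule for the coefficient of `S` in a product one of
whose factors has no constant term. -/

namespace BurungaleTian2019

section CyclotomicDerivative

variable {A : Type u} [CommRing A]

/-- **Leibniz at `S = 0`**: if `G` has no constant term then the coefficient of `S` in `G · H` is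
`G'(0) · H(0)`. [folklore] -/
theorem coeff_one_mul_of_constantCoeff_eq_zero (G H : PowerSeries A)
    (hG : PowerSeries.constantCoeff G = 0) :
    PowerSeries.coeff 1 (G * H) = PowerSeries.coeff 1 G * PowerSeries.constantCoeff H := by
  rw [PowerSeries.coeff_mul, Finset.Nat.sum_antidiagonal_succ, Finset.Nat.antidiagonal_zero,
    Finset.sum_singleton, PowerSeries.coeff_zero_eq_constantCoeff_apply, hG, zero_mul, zero_add]
  show PowerSeries.coeff (0 + 1) G * PowerSeries.coeff 0 H = _
  rw [zero_add, PowerSeries.coeff_zero_eq_constantCoeff_apply]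

/-- **Cor. 3.16 (cyclotomic derivative of the factorisation).** Over the anticyclotomic algebra `A`,
let `Lgχ`, `Lλ`, `Lψ ∈ A⟦S⟧` be the two-variable `p`-adic `L`-functions `L_p(g × χ)`, `L_Σ(λ)`,
`L_Σ*(ψ*χ)` expanded in the cyclotomic variable `S`, with Lemma 3.14 `L_p(g × χ) = c · L_Σ(λ) ·
L_Σ*(ψ*χ)` (`c` the constant of "`≐`") and `L⁻_Σ(λ) = 0` (the anticyclotomic line is self-dual of
sign `-1`). Then `L'_p(g × χ) = c · L'_Σ(λ) · L⁻_Σ*(ψ*χ)`.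
[cite: BurungaleTian2019, Cor. 3.16 and its proof (pp. 240–241), Lemma 3.14 (p. 240)] -/
theorem cyclotomicDerivative_eq_of_factorisation {Lgχ Llam Lψ : PowerSeries A} {c : A}
    (h314 : Lgχ = PowerSeries.C c * (Llam * Lψ)) (hvan : PowerSeries.constantCoeff Llam = 0) :
    PowerSeries.coeff 1 Lgχ = c * (PowerSeries.coeff 1 Llam * PowerSeries.constantCoeff Lψ) := by
  rw [h314, PowerSeries.coeff_C_mul, coeff_one_mul_of_constantCoeff_eq_zero Llam Lψ hvan]

/-- The anticyclotomic projection of `L_p(g × χ)` vanishes too ("`L⁻_p(g × χ) = L⁻_Σ(λ) = 0`").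
[cite: BurungaleTian2019, proof of Cor. 3.16 (p. 241)] -/
theorem constantCoeff_eq_zero_of_factorisation {Lgχ Llam Lψ : PowerSeries A} {c : A}
    (h314 : Lgχ = PowerSeries.C c * (Llam * Lψ)) (hvan : PowerSeries.constantCoeff Llam = 0) :
    PowerSeries.constantCoeff Lgχ = 0 := by
  rw [h314, map_mul, map_mul, hvan, zero_mul, mul_zero]

/-- **Cor. 3.16 as the ideal equality `(L'_p(g × χ)) = (L'_Σ(λ)) · (L⁻_Σ*(ψ*χ))` used in §3.4**
(hypothesis `h316` of `charIdeal_mul_conj_eq_of_gl1MainConjectures`), when the constant `c` of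
"`≐`" is a unit of `A` (as it is in the rational anticyclotomic algebra, `c ∈ ℚ_p^×`).
[cite: BurungaleTian2019, Cor. 3.16 (p. 241) and §3.4 "HMC" (p. 244)] -/
theorem span_cyclotomicDerivative_eq_of_factorisation {Lgχ Llam Lψ : PowerSeries A} {c : A}
    (hc : IsUnit c) (h314 : Lgχ = PowerSeries.C c * (Llam * Lψ))
    (hvan : PowerSeries.constantCoeff Llam = 0) :
    Ideal.span {PowerSeries.coeff 1 Lgχ} =
      Ideal.span {PowerSeries.coeff 1 Llam} * Ideal.span {PowerSeries.constantCoeff Lψ} := by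
  rw [cyclotomicDerivative_eq_of_factorisation h314 hvan, Ideal.span_singleton_mul_left_unit hc,
    Ideal.span_singleton_mul_span_singleton]

end CyclotomicDerivative

end BurungaleTian2019

end Literature.NumberTheory.EllipticCurves

end
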